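import Summits.AtomisticToContinuum.BoseEinsteinCondensation.Theorems.BECCutLineWeakDisorderGroundStateRigidityHardCoreOfConnected
import HarnessLib

/-!
# Crux `GroundStateRigidity` (stmt-AtomisticToContinuum-9072), line `Sketch` (skeleton v9):
# helpers for the registered stub `stub_sectorExclusion` (Stub C) — sectors of the free region

Supports (does not close) stmt-AtomisticToContinuum-9072; second auxiliary file of stub
`stub_sectorExclusion` of line Sketch (lead c5), namespace `GroundStateRigidity.SectorExclusion`
(independent of the first). Pure point-set bookkeeping on the open free region `F = free N L b`:

* `nbr N b i` — configurations at which particle `i` has a neighbour within `2b`;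
  `pm N L b X` — the finset of PERMANENT MEMBERS of the component of `X` in `F` (labels `i` with
  `comp_F(X) ⊆ nbr i`); it is constant along components (`pm_eq_of_mem`).
* `sector N L b 𝒜 = {X ∈ F | pm X ∈ 𝒜}` for a family `𝒜` of finsets: a union of components of
  `F`, hence OPEN (`isOpen_sector`); `sector 𝒜` and `sector 𝒜ᶜ` are disjoint and cover `F`.
* Relabelling `X ↦ X ∘ σ` preserves `F`, maps components to components, and
  `j ∈ pm (X ∘ σ) ↔ σ j ∈ pm X` (`mem_pm_comp_perm_iff`), so `#pm` is invariant and the sectors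
  `{#pm = m}` are `S_N`-invariant while `{i ∈ pm, #pm = m}` is invariant under the permutations
  fixing `i`.
* Counting: `∑ᵢ 1_{i ∈ pm, #pm = m} = m · 1_{#pm = m}` and `1_{#pm ≠ 0} = ∑_{m=1}^{N} 1_{#pm = m}`
  (`sum_indicator_member`, `indicator_crowded_eq_sum`).
-/

noncomputable section

open MeasureTheory Filter Set Metric
open scoped ENNReal NNReal Topology

namespace Summit.AtomisticToContinuum.BoseEinsteinCondensation.Theorems.GroundStateRigidity

open Literature.MathematicalPhysics.QuantumManyBody.BoseGas

namespace SectorExclusion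

variable {N : ℕ} {L b : ℝ}

/-! ### The free region, permanent members and sectors -/

/-- The free region `F_b(N, L) = {X ∈ Λ_L^N : |xᵢ - xⱼ| > b ∀ i ≠ j}` (stated inline in the
stubs of line `Sketch`; a `def` for the bookkeeping of this stub only). [folklore] -/
def free (N : ℕ) (L b : ℝ) : Set (Config N) :=
  {Z : Config N | Z ∈ boxN N L ∧ ∀ i j : Fin N, i ≠ j → b < dist (Z i) (Z j)}

/-- The free region is open. [folklore] -/
theorem isOpen_free (N : ℕ) (L b : ℝ) : IsOpen (free N L b) :=
  HardCoreOfConnected.isOpen_free N L b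

/-- `nbr N b i`: the configurations at which particle `i` has another particle within `2b`.
[folklore] -/
def nbr (N : ℕ) (b : ℝ) (i : Fin N) : Set (Config N) :=
  {Y : Config N | ∃ j : Fin N, j ≠ i ∧ dist (Y i) (Y j) ≤ 2 * b}

open Classical in
/-- The PERMANENT MEMBERS of the component of `X` in the free region: the labels `i` such that
particle `i` has a neighbour within `2b` at every configuration of the component (all labels if
`X` is not free, the component being empty). [folklore] -/
def pm (N : ℕ) (L b : ℝ) (X : Config N) : Finset (Fin N) :=
  Finset.univ.filter fun i => ∀ Y ∈ connectedComponentIn (free N L b) X, Y ∈ nbr N b i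

/-- Membership in `pm`. [folklore] -/
theorem mem_pm {X : Config N} {i : Fin N} :
    i ∈ pm N L b X ↔ ∀ Y ∈ connectedComponentIn (free N L b) X, Y ∈ nbr N b i := by
  classical
  simp [pm]

/-- `pm` is constant along components of the free region. [folklore] -/
theorem pm_eq_of_mem {X Y : Config N} (hY : Y ∈ connectedComponentIn (free N L b) X) :
    pm N L b Y = pm N L b X := by
  ext i
  simp only [mem_pm, connectedComponentIn_eq hY]

/-- A free configuration with `i` a permanent member has a neighbour of `i` within `2b`.
[folklore] -/
theorem mem_nbr_of_mem_pm {X : Config N} {i : Fin N} (hX : X ∈ free N L b) (hi : i ∈ pm N L b X) :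
    X ∈ nbr N b i :=
  mem_pm.1 hi X (mem_connectedComponentIn hX)

/-- The SECTOR of the family `𝒜`: free configurations whose set of permanent members lies in
`𝒜` (a union of connected components of the free region). [folklore] -/
def sector (N : ℕ) (L b : ℝ) (𝒜 : Set (Finset (Fin N))) : Set (Config N) :=
  {X : Config N | X ∈ free N L b ∧ pm N L b X ∈ 𝒜}

/-- Sectors lie in the free region. [folklore] -/
theorem sector_subset_free (𝒜 : Set (Finset (Fin N))) : sector N L b 𝒜 ⊆ free N L b :=
  fun _ h => h.1

/-- **Sectors are open**: with a point they contain its (open) component. [folklore] -/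
theorem isOpen_sector (𝒜 : Set (Finset (Fin N))) : IsOpen (sector N L b 𝒜) := by
  rw [isOpen_iff_mem_nhds]
  rintro X ⟨hXF, hXA⟩
  have hC : IsOpen (connectedComponentIn (free N L b) X) := (isOpen_free N L b).connectedComponentIn
  refine mem_of_superset (hC.mem_nhds (mem_connectedComponentIn hXF)) fun Y hY => ?_
  refine ⟨connectedComponentIn_subset _ _ hY, ?_⟩
  show pm N L b Y ∈ 𝒜
  rw [pm_eq_of_mem hY]
  exact hXA

/-- Sectors are measurable. [folklore] -/
theorem measurableSet_sector (𝒜 : Set (Finset (Fin N))) : MeasurableSet (sector N L b 𝒜) :=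
  (isOpen_sector 𝒜).measurableSet

/-- Complementary sectors are disjoint. [folklore] -/
theorem disjoint_sector_compl (𝒜 : Set (Finset (Fin N))) :
    Disjoint (sector N L b 𝒜) (sector N L b 𝒜ᶜ) :=
  Set.disjoint_left.2 fun _ h1 h2 => h2.2 h1.2

/-- Complementary sectors cover the free region. [folklore] -/
theorem not_mem_free_of_not_mem_sector {𝒜 : Set (Finset (Fin N))} {X : Config N}
    (h1 : X ∉ sector N L b 𝒜) (h2 : X ∉ sector N L b 𝒜ᶜ) : X ∉ free N L b := fun hF => by
  by_cases h : pm N L b X ∈ 𝒜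
  exacts [h1 ⟨hF, h⟩, h2 ⟨hF, h⟩]

/-- The union of two complementary sectors is the free region (as indicators of a function
vanishing off the free region). [folklore] -/
theorem indicator_sector_add_compl (𝒜 : Set (Finset (Fin N))) {h : Config N → ℝ≥0∞}
    (h0 : ∀ X, X ∉ free N L b → h X = 0) (X : Config N) :
    (sector N L b 𝒜).indicator h X + (sector N L b 𝒜ᶜ).indicator h X = h X := by
  by_cases hF : X ∈ free N L b
  · by_cases hA : pm N L b X ∈ 𝒜
    · have hX : X ∈ sector N L b 𝒜 := ⟨hF, hA⟩
      have hX' : X ∉ sector N L b 𝒜ᶜ := fun h' => h'.2 hA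
      rw [indicator_of_mem hX, indicator_of_notMem hX', add_zero]
    · have hX : X ∉ sector N L b 𝒜 := fun h' => hA h'.2
      have hX' : X ∈ sector N L b 𝒜ᶜ := ⟨hF, hA⟩
      rw [indicator_of_notMem hX, indicator_of_mem hX', zero_add]
  · have hX : X ∉ sector N L b 𝒜 := fun h' => hF h'.1
    have hX' : X ∉ sector N L b 𝒜ᶜ := fun h' => hF h'.1
    rw [indicator_of_notMem hX, indicator_of_notMem hX', add_zero, h0 X hF]

/-! ### Relabelling -/

/-- Relabelling the particles is continuous. [folklore] -/
theorem continuous_comp_perm (σ : Equiv.Perm (Fin N)) : Continuous fun X : Config N => X ∘ σ :=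
  continuous_pi fun j => continuous_apply (σ j)

/-- The free region is invariant under relabelling. [folklore] -/
theorem comp_perm_mem_free {X : Config N} (σ : Equiv.Perm (Fin N)) (hX : X ∈ free N L b) :
    (X ∘ σ) ∈ free N L b :=
  ⟨fun i => hX.1 (σ i), fun i j hij => hX.2 (σ i) (σ j) (σ.injective.ne hij)⟩

/-- Undoing a relabelling. [folklore] -/
theorem comp_perm_comp_symm (X : Config N) (σ : Equiv.Perm (Fin N)) : (X ∘ σ) ∘ σ.symm = X := by
  funext j
  simp

/-- Undoing a relabelling. [folklore] -/
theorem comp_symm_comp_perm (X : Config N) (σ : Equiv.Perm (Fin N)) : (X ∘ σ.symm) ∘ σ = X := by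
  funext j
  simp

/-- The free region is invariant under relabelling (iff form). [folklore] -/
theorem comp_perm_mem_free_iff {X : Config N} (σ : Equiv.Perm (Fin N)) :
    (X ∘ σ) ∈ free N L b ↔ X ∈ free N L b :=
  ⟨fun h => by simpa only [comp_perm_comp_symm] using comp_perm_mem_free σ.symm h,
    comp_perm_mem_free σ⟩

/-- Relabelling maps components of the free region into components. [folklore] -/
theorem comp_perm_mem_connectedComponentIn {X Y : Config N} (σ : Equiv.Perm (Fin N))
    (hX : X ∈ free N L b) (hY : Y ∈ connectedComponentIn (free N L b) X) :
    (Y ∘ σ) ∈ connectedComponentIn (free N L b) (X ∘ σ) := by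
  have himg : (fun Z : Config N => Z ∘ σ) '' free N L b ⊆ free N L b := by
    rintro _ ⟨Z, hZ, rfl⟩
    exact comp_perm_mem_free σ hZ
  exact connectedComponentIn_mono _ himg
    ((continuous_comp_perm σ).mapsTo_connectedComponentIn hX hY)

/-- Relabelling and neighbours: `X ∘ σ ∈ nbr j ↔ X ∈ nbr (σ j)`. [folklore] -/
theorem comp_perm_mem_nbr_iff {Y : Config N} (σ : Equiv.Perm (Fin N)) (j : Fin N) :
    (Y ∘ σ) ∈ nbr N b j ↔ Y ∈ nbr N b (σ j) := by
  constructor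
  · rintro ⟨j', hj', hd⟩
    exact ⟨σ j', σ.injective.ne hj', hd⟩
  · rintro ⟨k, hk, hd⟩
    refine ⟨σ.symm k, fun h => hk ?_, ?_⟩
    · rw [← h, Equiv.apply_symm_apply]
    · simpa using hd

/-- Relabelling and permanent members (one direction). [folklore] -/
theorem mem_pm_comp_perm_of {X : Config N} (σ : Equiv.Perm (Fin N)) {j : Fin N}
    (h : σ j ∈ pm N L b X) : j ∈ pm N L b (X ∘ σ) := by
  rw [mem_pm] at h ⊢
  intro Y' hY'
  have hXσ : (X ∘ σ) ∈ free N L b := by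
    by_contra hc
    rw [connectedComponentIn_eq_empty hc] at hY'
    exact hY'
  have h1 : (Y' ∘ σ.symm) ∈ connectedComponentIn (free N L b) X := by
    simpa only [comp_perm_comp_symm] using comp_perm_mem_connectedComponentIn σ.symm hXσ hY'
  have h2 := h _ h1
  rwa [← comp_perm_mem_nbr_iff σ, comp_symm_comp_perm] at h2

/-- **Relabelling and permanent members**: `j ∈ pm (X ∘ σ) ↔ σ j ∈ pm X`. [folklore] -/
theorem mem_pm_comp_perm_iff {X : Config N} (σ : Equiv.Perm (Fin N)) {j : Fin N} :
    j ∈ pm N L b (X ∘ σ) ↔ σ j ∈ pm N L b X := by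
  refine ⟨fun h => ?_, mem_pm_comp_perm_of σ⟩
  have h' := mem_pm_comp_perm_of (X := X ∘ σ) σ.symm (j := σ j) (by simpa using h)
  simpa only [comp_perm_comp_symm] using h'

/-- `pm (X ∘ σ)` is the image of `pm X` under `σ⁻¹`. [folklore] -/
theorem pm_comp_perm (X : Config N) (σ : Equiv.Perm (Fin N)) :
    pm N L b (X ∘ σ) = (pm N L b X).map σ.symm.toEmbedding := by
  ext j
  rw [mem_pm_comp_perm_iff, Finset.mem_map_equiv, Equiv.symm_symm]

/-- The number of permanent members is invariant under relabelling. [folklore] -/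
theorem card_pm_comp_perm (X : Config N) (σ : Equiv.Perm (Fin N)) :
    (pm N L b (X ∘ σ)).card = (pm N L b X).card := by
  rw [pm_comp_perm, Finset.card_map]

/-- The sector `{#pm = m}` is invariant under every relabelling. [folklore] -/
theorem comp_perm_mem_sector_card_iff (X : Config N) (σ : Equiv.Perm (Fin N)) (m : ℕ) :
    (X ∘ σ) ∈ sector N L b {s | s.card = m} ↔ X ∈ sector N L b {s | s.card = m} := by
  simp only [sector, mem_setOf_eq, comp_perm_mem_free_iff, card_pm_comp_perm]

/-- The sector `{i ∈ pm, #pm = m}` is invariant under the relabellings fixing `i`. [folklore] -/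
theorem comp_perm_mem_sector_member_iff (X : Config N) {σ : Equiv.Perm (Fin N)} {i : Fin N}
    (hσ : σ i = i) (m : ℕ) :
    (X ∘ σ) ∈ sector N L b {s | i ∈ s ∧ s.card = m} ↔
      X ∈ sector N L b {s | i ∈ s ∧ s.card = m} := by
  simp only [sector, mem_setOf_eq, comp_perm_mem_free_iff, card_pm_comp_perm,
    mem_pm_comp_perm_iff, hσ]

/-- An indicator of an invariant set times a symmetric function is symmetric. [folklore] -/
theorem indicator_comp_perm {T : Set (Config N)} {ψ : Config N → ℂ} {σ : Equiv.Perm (Fin N)}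
    (hT : ∀ X, (X ∘ σ) ∈ T ↔ X ∈ T) (hψ : ∀ X, ψ (X ∘ σ) = ψ X) (X : Config N) :
    T.indicator ψ (X ∘ σ) = T.indicator ψ X := by
  by_cases hX : X ∈ T
  · rw [indicator_of_mem hX, indicator_of_mem ((hT X).2 hX), hψ]
  · rw [indicator_of_notMem hX, indicator_of_notMem (mt (hT X).1 hX)]

/-! ### Counting permanent members -/

/-- **`m`-counting**: on `{#pm = m}` exactly `m` of the sectors `{i ∈ pm, #pm = m}` contain the
point: `∑ᵢ 1_{i ∈ pm, #pm = m} h = m · 1_{#pm = m} h`. [folklore] -/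
theorem sum_indicator_member (m : ℕ) (h : Config N → ℝ≥0∞) (X : Config N) :
    ∑ i : Fin N, (sector N L b {s | i ∈ s ∧ s.card = m}).indicator h X =
      (m : ℝ≥0∞) * (sector N L b {s | s.card = m}).indicator h X := by
  by_cases hX : X ∈ sector N L b {s | s.card = m}
  · have hF : X ∈ free N L b := hX.1
    have hcard' : (pm N L b X).card = m := hX.2
    have hi : ∀ i : Fin N, (sector N L b {s | i ∈ s ∧ s.card = m}).indicator h X =
        if i ∈ pm N L b X then h X else 0 := by
      intro i
      by_cases hi : i ∈ pm N L b X
      · have hXi : X ∈ sector N L b {s | i ∈ s ∧ s.card = m} := ⟨hF, hi, hcard'⟩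
        rw [if_pos hi, indicator_of_mem hXi]
      · have hXi : X ∉ sector N L b {s | i ∈ s ∧ s.card = m} := fun h' => hi h'.2.1
        rw [if_neg hi, indicator_of_notMem hXi]
    rw [indicator_of_mem hX, Finset.sum_congr rfl fun i _ => hi i,
      Finset.sum_ite_mem, Finset.univ_inter, Finset.sum_const, nsmul_eq_mul, hcard']
  · rw [indicator_of_notMem hX, mul_zero]
    refine Finset.sum_eq_zero fun i _ => indicator_of_notMem (fun h' => hX ⟨h'.1, h'.2.2⟩) _

/-- **Decomposition of the crowded sector by the number of permanent members**:
`1_{#pm ≠ 0} h = ∑_{m=1}^{N} 1_{#pm = m} h`. [folklore] -/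
theorem indicator_crowded_eq_sum (h : Config N → ℝ≥0∞) (X : Config N) :
    (sector N L b {s | s.card = 0}ᶜ).indicator h X =
      ∑ m ∈ Finset.Icc 1 N, (sector N L b {s | s.card = m}).indicator h X := by
  by_cases hF : X ∈ free N L b
  · have hm : ∀ m : ℕ, (sector N L b {s | s.card = m}).indicator h X =
        if (pm N L b X).card = m then h X else 0 := by
      intro m
      by_cases hc : (pm N L b X).card = m
      · have hXm : X ∈ sector N L b {s | s.card = m} := ⟨hF, hc⟩
        rw [if_pos hc, indicator_of_mem hXm]
      · have hXm : X ∉ sector N L b {s | s.card = m} := fun h' => hc h'.2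
        rw [if_neg hc, indicator_of_notMem hXm]
    rw [Finset.sum_congr rfl fun m _ => hm m, Finset.sum_ite_eq]
    have hle : (pm N L b X).card ≤ N := (Finset.card_le_univ _).trans_eq (Fintype.card_fin N)
    by_cases h0 : (pm N L b X).card = 0
    · have hX0 : X ∉ sector N L b {s | s.card = 0}ᶜ := fun h' => h'.2 h0
      rw [indicator_of_notMem hX0, if_neg]
      simp [h0]
    · have hX0 : X ∈ sector N L b {s | s.card = 0}ᶜ := ⟨hF, h0⟩
      rw [indicator_of_mem hX0, if_pos]
      exact Finset.mem_Icc.2 ⟨Nat.pos_of_ne_zero h0, hle⟩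
  · have hX0 : X ∉ sector N L b {s | s.card = 0}ᶜ := fun h' => hF h'.1
    rw [indicator_of_notMem hX0]
    refine (Finset.sum_eq_zero fun m _ => ?_).symm
    have hXm : X ∉ sector N L b {s | s.card = m} := fun h' => hF h'.1
    exact indicator_of_notMem hXm _

/-- The crowded sector `{#pm ≠ 0}` is the set `U'` of the stub: free configurations some label
of which is a permanent member of their component. [folklore] -/
theorem mem_sector_crowded_iff (X : Config N) :
    X ∈ sector N L b {s | s.card = 0}ᶜ ↔
      X ∈ free N L b ∧ ∃ i : Fin N, ∀ Y ∈ connectedComponentIn (free N L b) X,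
        ∃ j : Fin N, j ≠ i ∧ dist (Y i) (Y j) ≤ 2 * b := by
  simp only [sector, mem_setOf_eq, mem_compl_iff, Finset.card_eq_zero, ← ne_eq,
    ← Finset.nonempty_iff_ne_empty, Finset.Nonempty, mem_pm, nbr]

end SectorExclusion

end Summit.AtomisticToContinuum.BoseEinsteinCondensation.Theorems.GroundStateRigidity

end
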